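import Literature.AnabelianGeometry.EtaleTheta.FrobenioidMonoThetaThm510iSub
import Literature.AnabelianGeometry.EtaleTheta.FrobenioidKummerOut
import Literature.AnabelianGeometry.EtaleTheta.Discharge.Sec5UnitsTransport
import Mathlib.Tactic.Group
import HarnessLib

/-!
# [EtTh] Lemma 5.8: the `K^×`-extension of the constants' action on `E_N` from a birational Galois action (p. 331 / PDF p. 105)

Mochizuki, *The étale theta function and its Frobenioid-theoretic manifestations*, Publ. RIMS **45**
(2009) [cite: MochizukiEtTh2009, Lem 5.8 p.331 (PDF p.105)].  Layer L2 of the abc-iut cell, sub-DAG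
`plan/L2/SUBDAG-EtTh-Thm510i.md`, proof row **L58-B1-abs** (holder abc-iut-w4-d095).  PROOF-ONLY (no
definitions) over `FrobenioidMonoThetaThm510iSub.lean` (p417278: `IsKummerExtension`, `KxOuterActionExtends`).

Lemma 5.8: "we have a natural outer action of `(O_K^×)^{1/N}/μ_N(B_N) (⥲ O_K^×)` on `E_N`; this outer
action EXTENDS to an outer action of `(K^×)^{1/N}/μ_N(B_N) (⥲ K^×)` on `E_N`."  The elements of
`(K^×)^{1/N} ⊆ O^×(B_N^birat)` are not automorphisms of `B_N`; they act on `E_N` through their KUMMER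
COCYCLES `c_f(g) = f · g(f)⁻¹ ∈ μ_N(B_N)` (`f^N ∈ K^×` is Galois-fixed), for the Galois action of
`Aut_D(B_N^bs)` on the rational functions `O^×(B_N^birat)` ([FrdI] Prop. 4.4 / Def. 4.1 (i): the
birationalisation `C → C^birat` is a functor, so `Aut` acts on `O^×((-)^birat)`).  abc-iut-L2-t4's abstract
§5 data `ThetaFrobenioid` carry no such action (MERGE-PLAN row 11: "needs `Aut_{C^birat}(B_N^birat) ↷ E_N`";
at the model it is abc-iut-L2-t9's `biratAutModel`).  This file takes the action as THEOREM BINDERS —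
a homomorphism `gal : Aut_D(B_N^bs) → Aut(O^×(B_N^birat))` with
(h2) compatibility with the action on units through `s^⊓-gp_N`:
     `ι(s^⊓-gp_N(g) · u · s^⊓-gp_N(g)⁻¹) = gal g (ι u)` for `ι : O^×(B_N) ↪ O^×(B_N^birat)`,
(h3) the constants `K^× ↪ O^×(B_N^birat)` are Galois-fixed,
(h5) every `N`-torsion element of `O^×(B_N^birat)` is (the image of) a unit —
and CONSTRUCTS the extension: `kxOuterActionExtends_of_galoisAction` proves `KxOuterActionExtends`
(`∃ act : (K^×)^{1/N} →* Aut(E_N)`, Kummer shifts, `= conjugation` on `(O_K^×)^{1/N}`), with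
`act f (e) := c_f(e^bs) · e`.  NO "invariants = constants" input is needed for the EXTENSION (that input,
`InvariantUnitsEqConstants`, is what the EQUALITY `(O_K^×)^{1/N} = N(E_N) ∩ O^×(B_N)` of Lemma 5.8 uses).
The cocycle is handled as a function `ζ` with its defining equation `hζ` (lemmas `kc_*`), chosen by (h5)
and the injectivity of `ι` inside the final proof.  CONSTRUCTION OF RECORD at the level of `E^Π_N` /
`Out(E^Π_N)` (the `DK` slot itself): abc-iut-L2-t11's `FrobenioidKummerOut.lean` (p417098: hypothesis structure
`BiratAutAction` = the action of `Aut_C(B_N)` on `O^×(B_N^birat)` with its three laws; `kummerCocycle`,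
`kummerAutHom`, `kummerOut`).  This file is the `E_N`-level statement of Lemma 5.8 as printed ("outer action …
on `E_N`"), for the weaker datum of an action of `Aut_D(B_N^bs)`; `kxOuterActionExtends_of_biratAutAction`
instantiates it at abc-iut-L2-t11's datum (`gal := act ∘ s^⊓-gp_N`), so row L58-B1 of the sub-DAG is DERIVED
modulo {`SgpCapSection`, `BiratAutAction`, `KxRootNModCyclotome`} — the same currency as
`Discharge/Sec5KummerOutTransport.lean`.

HONEST FRAMING: a kernel-checked construction over the abstract §5 data from stated binders; [EtTh] is
refereed; typed ≠ proved for the genuine data (the binders are discharged there, abc-iut-L2-t4 row 11);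
nothing here bears on [IUTchIII] Cor. 3.12 or takes a side.
-/

namespace Literature.AnabelianGeometry.EtaleTheta

open CategoryTheory

universe w v v' u u'

namespace ThetaFrobenioid

variable {C : Type u} [Category.{v} C] {D : Type u'} [Category.{v'} D] (𝔉 : ThetaFrobenioid.{w} C D)

section KummerCocycle

variable (gal : Aut (𝔉.base.obj 𝔉.BN) →* MulAut (𝔉.biratUnits 𝔉.BN))
  (ζ : 𝔉.KxRootN → Aut (𝔉.base.obj 𝔉.BN) → 𝔉.units 𝔉.BN)
  (hζ : ∀ (f : 𝔉.KxRootN) (g : Aut (𝔉.base.obj 𝔉.BN)),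
    𝔉.unitsToBirat 𝔉.BN (ζ f g) = (f : 𝔉.biratUnits 𝔉.BN) * (gal g (f : 𝔉.biratUnits 𝔉.BN))⁻¹)

/-- The Kummer cocycle of `f ∈ (K^×)^{1/N}` is `N`-torsion: `(f · g(f)⁻¹)^N = f^N · g(f^N)⁻¹ = 1` since
`f^N ∈ K^×` is Galois-fixed (h3). [cite: MochizukiEtTh2009, Lem 5.8 p.331 (PDF p.105)] -/
theorem kc_birat_pow_eq_one (h3 : ∀ (g : Aut (𝔉.base.obj 𝔉.BN)) (k : 𝔉.Kˣ), gal g (𝔉.constEmb k) = 𝔉.constEmb k)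
    (f : 𝔉.KxRootN) (g : Aut (𝔉.base.obj 𝔉.BN)) :
    ((f : 𝔉.biratUnits 𝔉.BN) * (gal g (f : 𝔉.biratUnits 𝔉.BN))⁻¹) ^ (𝔉.N : ℕ) = 1 := by
  obtain ⟨k, hk⟩ := (𝔉.mem_KxRootN).mp f.2
  rw [mul_pow, inv_pow, ← map_pow, ← hk, h3, mul_inv_cancel]

/-- The Kummer cocycle of `f ∈ (K^×)^{1/N}` lies in `(K^×)^{1/N}` (its `N`-th power is the constant `1`).
[cite: MochizukiEtTh2009, Lem 5.8 p.331 (PDF p.105)] -/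
theorem kc_birat_mem_KxRootN (h3 : ∀ (g : Aut (𝔉.base.obj 𝔉.BN)) (k : 𝔉.Kˣ), gal g (𝔉.constEmb k) = 𝔉.constEmb k)
    (f : 𝔉.KxRootN) (g : Aut (𝔉.base.obj 𝔉.BN)) :
    (f : 𝔉.biratUnits 𝔉.BN) * (gal g (f : 𝔉.biratUnits 𝔉.BN))⁻¹ ∈ 𝔉.KxRootN := by
  rw [𝔉.mem_KxRootN, 𝔉.kc_birat_pow_eq_one gal h3 f g]
  exact one_mem _

include hζ in
/-- `ζ_f(g)^N = 1` in `O^×(B_N)` (injectivity of `O^×(B_N) ↪ O^×(B_N^birat)`).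
[cite: MochizukiEtTh2009, Lem 5.8 p.331 (PDF p.105)] -/
theorem kc_pow_eq_one (h3 : ∀ (g : Aut (𝔉.base.obj 𝔉.BN)) (k : 𝔉.Kˣ), gal g (𝔉.constEmb k) = 𝔉.constEmb k)
    (f : 𝔉.KxRootN) (g : Aut (𝔉.base.obj 𝔉.BN)) : ζ f g ^ (𝔉.N : ℕ) = 1 := by
  apply 𝔉.unitsToBirat_injective 𝔉.BN
  rw [map_pow, hζ, 𝔉.kc_birat_pow_eq_one gal h3, map_one]

include hζ in
/-- `ζ_f(g) ∈ μ_N(B_N)`. [cite: MochizukiEtTh2009, Lem 5.8 p.331 (PDF p.105)] -/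
theorem kc_mem_muTorsion (h3 : ∀ (g : Aut (𝔉.base.obj 𝔉.BN)) (k : 𝔉.Kˣ), gal g (𝔉.constEmb k) = 𝔉.constEmb k)
    (f : 𝔉.KxRootN) (g : Aut (𝔉.base.obj 𝔉.BN)) :
    ((ζ f g : 𝔉.units 𝔉.BN) : Aut 𝔉.BN) ∈ 𝔉.muTorsion 𝔉.BN 𝔉.N := by
  rw [mem_muTorsion]
  refine ⟨(ζ f g).2, ?_⟩
  have h := congrArg Subtype.val (𝔉.kc_pow_eq_one gal ζ hζ h3 f g)
  simpa [Subgroup.coe_pow] using h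

/-- A unit has trivial base image. [cite: MochizukiEtTh2009, §5 p.330 (PDF p.104)] -/
theorem autBase_coe_units (u : 𝔉.units 𝔉.BN) : 𝔉.autBase 𝔉.BN (u : Aut 𝔉.BN) = 1 :=
  𝔉.base_map_units_aut u.2

/-- The shift `e ↦ ζ · e` by a unit does not change the base image. [cite: MochizukiEtTh2009, Lem 5.8 p.331 (PDF p.105)] -/
theorem autBase_units_mul (u : 𝔉.units 𝔉.BN) (e : Aut 𝔉.BN) :
    𝔉.autBase 𝔉.BN ((u : Aut 𝔉.BN) * e) = 𝔉.autBase 𝔉.BN e := by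
  rw [map_mul, autBase_coe_units, one_mul]

include hζ in
/-- `ζ_1 = 1`. [cite: MochizukiEtTh2009, Lem 5.8 p.331 (PDF p.105)] -/
theorem kc_one (g : Aut (𝔉.base.obj 𝔉.BN)) : ζ 1 g = 1 := by
  apply 𝔉.unitsToBirat_injective 𝔉.BN
  rw [hζ, map_one]
  simp

include hζ in
/-- `ζ_{ff'} = ζ_f · ζ_{f'}` (`O^×(B_N^birat)` is commutative). [cite: MochizukiEtTh2009, Lem 5.8 p.331 (PDF p.105)] -/
theorem kc_mul (f f' : 𝔉.KxRootN) (g : Aut (𝔉.base.obj 𝔉.BN)) : ζ (f * f') g = ζ f g * ζ f' g := by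
  apply 𝔉.unitsToBirat_injective 𝔉.BN
  rw [map_mul, hζ, hζ, hζ]
  simp only [Subgroup.coe_mul, map_mul, mul_inv_rev]
  simp only [mul_comm, mul_left_comm, mul_assoc]

/-- An element of `E_N` is `s^⊓-gp_N(e^bs) · ζ'` with `ζ' ∈ μ_N(B_N)` (given the section property of
`s^⊓-gp_N`). [cite: MochizukiEtTh2009, Lem 5.9 (ii) p.332 (PDF p.106)] -/
theorem exists_eq_sgpCap_mul (hsec : 𝔉.SgpCapSection) {e : Aut 𝔉.BN} (he : e ∈ 𝔉.EN) :
    ∃ ζ' ∈ 𝔉.muTorsion 𝔉.BN 𝔉.N, e = 𝔉.sgpCap (𝔉.autBase 𝔉.BN e) * ζ' := by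
  haveI := 𝔉.muTorsion_normal 𝔉.BN 𝔉.N
  obtain ⟨y, -, ζ', hζ', rfl⟩ :=
    (mem_sectionSubgroup_iff 𝔉.sgpCap 𝔉.imPiY (𝔉.muTorsion 𝔉.BN 𝔉.N)).mp he
  refine ⟨ζ', hζ', ?_⟩
  rw [map_mul, hsec, 𝔉.base_map_units_aut (𝔉.muTorsion_le_units 𝔉.BN 𝔉.N hζ'), mul_one]

/-- Conjugating a unit by an element `e ∈ E_N` is conjugating it by `s^⊓-gp_N(e^bs)` (units commute).
[cite: MochizukiEtTh2009, Lem 5.8 p.331 (PDF p.105)] -/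
theorem conj_units_eq_conj_sgpCap (hsec : 𝔉.SgpCapSection) {e : Aut 𝔉.BN} (he : e ∈ 𝔉.EN)
    (u : 𝔉.units 𝔉.BN) :
    e * (u : Aut 𝔉.BN) * e⁻¹ =
      𝔉.sgpCap (𝔉.autBase 𝔉.BN e) * (u : Aut 𝔉.BN) * (𝔉.sgpCap (𝔉.autBase 𝔉.BN e))⁻¹ := by
  obtain ⟨ζ', hζ', heq⟩ := 𝔉.exists_eq_sgpCap_mul hsec he
  have hc : ζ' * (u : Aut 𝔉.BN) = (u : Aut 𝔉.BN) * ζ' :=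
    setLike_mul_comm (s := 𝔉.units 𝔉.BN) (𝔉.muTorsion_le_units 𝔉.BN 𝔉.N hζ') u.2
  set s := 𝔉.sgpCap (𝔉.autBase 𝔉.BN e) with hs
  rw [heq]
  calc s * ζ' * (u : Aut 𝔉.BN) * (s * ζ')⁻¹ = s * (ζ' * (u : Aut 𝔉.BN)) * ζ'⁻¹ * s⁻¹ := by group
    _ = s * ((u : Aut 𝔉.BN) * ζ') * ζ'⁻¹ * s⁻¹ := by rw [hc]
    _ = s * (u : Aut 𝔉.BN) * s⁻¹ := by group

/-- The conjugate of a unit by `e ∈ E_N` is a unit. [cite: MochizukiEtTh2009, Lem 5.8 p.331 (PDF p.105)] -/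
theorem conj_units_mem (e : Aut 𝔉.BN) (u : 𝔉.units 𝔉.BN) : e * (u : Aut 𝔉.BN) * e⁻¹ ∈ 𝔉.units 𝔉.BN :=
  (𝔉.units_normal 𝔉.BN).conj_mem _ u.2 e

include hζ in
/-- COCYCLE IDENTITY: `ζ_f(g₁ g₂) = ζ_f(g₁) · e₁ ζ_f(g₂) e₁⁻¹` for `e₁ ∈ E_N` over `g₁` — from
`c_f(g₁g₂) = c_f(g₁) · g₁(c_f(g₂))` and the compatibility (h2) of `gal` with the action on units.
[cite: MochizukiEtTh2009, Lem 5.8 p.331 (PDF p.105)] -/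
theorem kc_cocycle (hsec : 𝔉.SgpCapSection)
    (h2 : ∀ (g : Aut (𝔉.base.obj 𝔉.BN)) (u : 𝔉.units 𝔉.BN)
      (hu' : 𝔉.sgpCap g * (u : Aut 𝔉.BN) * (𝔉.sgpCap g)⁻¹ ∈ 𝔉.units 𝔉.BN),
      𝔉.unitsToBirat 𝔉.BN ⟨_, hu'⟩ = gal g (𝔉.unitsToBirat 𝔉.BN u))
    (f : 𝔉.KxRootN) {e₁ : Aut 𝔉.BN} (he₁ : e₁ ∈ 𝔉.EN) (g₂ : Aut (𝔉.base.obj 𝔉.BN)) :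
    ((ζ f (𝔉.autBase 𝔉.BN e₁ * g₂) : 𝔉.units 𝔉.BN) : Aut 𝔉.BN) =
      (ζ f (𝔉.autBase 𝔉.BN e₁) : Aut 𝔉.BN) * (e₁ * (ζ f g₂ : Aut 𝔉.BN) * e₁⁻¹) := by
  set g₁ := 𝔉.autBase 𝔉.BN e₁ with hg₁
  have hconj : e₁ * ((ζ f g₂ : 𝔉.units 𝔉.BN) : Aut 𝔉.BN) * e₁⁻¹ =
      𝔉.sgpCap g₁ * (ζ f g₂ : Aut 𝔉.BN) * (𝔉.sgpCap g₁)⁻¹ :=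
    𝔉.conj_units_eq_conj_sgpCap hsec he₁ (ζ f g₂)
  have hmem : 𝔉.sgpCap g₁ * ((ζ f g₂ : 𝔉.units 𝔉.BN) : Aut 𝔉.BN) * (𝔉.sgpCap g₁)⁻¹ ∈ 𝔉.units 𝔉.BN :=
    (𝔉.units_normal 𝔉.BN).conj_mem _ (ζ f g₂).2 _
  have key : ζ f (g₁ * g₂) = ζ f g₁ * ⟨_, hmem⟩ := by
    apply 𝔉.unitsToBirat_injective 𝔉.BN
    rw [map_mul, hζ, hζ, h2 g₁ (ζ f g₂) hmem, hζ, map_mul]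
    simp only [MulAut.mul_apply, map_mul, map_inv]
    group
  have := congrArg Subtype.val key
  simpa [hconj] using this

include hζ in
/-- VALUE ON A CONSTANT: for `u ∈ (O_K^×)^{1/N}` and `e ∈ E_N`, `ζ_u(e^bs) = u · e u⁻¹ e⁻¹`, i.e. the shift by
`ζ_u` IS conjugation by `u`. [cite: MochizukiEtTh2009, Lem 5.8 p.331 (PDF p.105)] -/
theorem kc_units (hsec : 𝔉.SgpCapSection)
    (h2 : ∀ (g : Aut (𝔉.base.obj 𝔉.BN)) (u : 𝔉.units 𝔉.BN)
      (hu' : 𝔉.sgpCap g * (u : Aut 𝔉.BN) * (𝔉.sgpCap g)⁻¹ ∈ 𝔉.units 𝔉.BN),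
      𝔉.unitsToBirat 𝔉.BN ⟨_, hu'⟩ = gal g (𝔉.unitsToBirat 𝔉.BN u))
    (u : 𝔉.units 𝔉.BN) (hu : 𝔉.unitsToBirat 𝔉.BN u ∈ 𝔉.KxRootN) {e : Aut 𝔉.BN} (he : e ∈ 𝔉.EN) :
    ((ζ ⟨𝔉.unitsToBirat 𝔉.BN u, hu⟩ (𝔉.autBase 𝔉.BN e) : 𝔉.units 𝔉.BN) : Aut 𝔉.BN) * e =
      (u : Aut 𝔉.BN) * e * (u : Aut 𝔉.BN)⁻¹ := by
  set g := 𝔉.autBase 𝔉.BN e with hg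
  have hmem : 𝔉.sgpCap g * (u : Aut 𝔉.BN) * (𝔉.sgpCap g)⁻¹ ∈ 𝔉.units 𝔉.BN :=
    (𝔉.units_normal 𝔉.BN).conj_mem _ u.2 _
  have key : ζ ⟨𝔉.unitsToBirat 𝔉.BN u, hu⟩ g = u * ⟨_, hmem⟩⁻¹ := by
    apply 𝔉.unitsToBirat_injective 𝔉.BN
    rw [hζ, map_mul, map_inv, h2 g u hmem]
  have hval := congrArg Subtype.val key
  simp only [Subgroup.coe_mul, Subgroup.coe_inv] at hval
  rw [hval]
  have hue : (u : Aut 𝔉.BN) * e * (u : Aut 𝔉.BN)⁻¹ * e⁻¹ =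
      (u : Aut 𝔉.BN) * (e * (u : Aut 𝔉.BN) * e⁻¹)⁻¹ := by group
  have h2' := 𝔉.conj_units_eq_conj_sgpCap hsec he u
  calc (u : Aut 𝔉.BN) * (𝔉.sgpCap g * (u : Aut 𝔉.BN) * (𝔉.sgpCap g)⁻¹)⁻¹ * e
      = (u : Aut 𝔉.BN) * (e * (u : Aut 𝔉.BN) * e⁻¹)⁻¹ * e := by rw [← h2']
    _ = (u : Aut 𝔉.BN) * e * (u : Aut 𝔉.BN)⁻¹ := by group

end KummerCocycle

/-- **[EtTh] Lemma 5.8, the `K^×`-extension, CONSTRUCTED from a birational Galois action.**  Let the §5 data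
carry the section property of `s^⊓-gp_N` and a homomorphism `gal : Aut_D(B_N^bs) → Aut(O^×(B_N^birat))`
(h2) compatible with the conjugation action on `O^×(B_N) ⊆ O^×(B_N^birat)` through `s^⊓-gp_N`, (h3) fixing
the constants `K^×`, and (h5) such that the `N`-torsion of `O^×(B_N^birat)` consists of units.  Then the
conjugation action of `(O_K^×)^{1/N}` on `E_N` EXTENDS to a Kummer action of `(K^×)^{1/N}`
(`KxOuterActionExtends`): `act f (e) := ζ_f(e^bs) · e` with `ι(ζ_f(g)) = f · gal g (f)⁻¹` the Kummer cocycle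
of `f` — "this outer action extends to an outer action of `(K^×)^{1/N}/μ_N(B_N) (⥲ K^×) on E_N`".
[cite: MochizukiEtTh2009, Lem 5.8 p.331 (PDF p.105)] -/
theorem kxOuterActionExtends_of_galoisAction (hsec : 𝔉.SgpCapSection)
    (gal : Aut (𝔉.base.obj 𝔉.BN) →* MulAut (𝔉.biratUnits 𝔉.BN))
    (h2 : ∀ (g : Aut (𝔉.base.obj 𝔉.BN)) (u : 𝔉.units 𝔉.BN)
      (hu' : 𝔉.sgpCap g * (u : Aut 𝔉.BN) * (𝔉.sgpCap g)⁻¹ ∈ 𝔉.units 𝔉.BN),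
      𝔉.unitsToBirat 𝔉.BN ⟨_, hu'⟩ = gal g (𝔉.unitsToBirat 𝔉.BN u))
    (h3 : ∀ (g : Aut (𝔉.base.obj 𝔉.BN)) (k : 𝔉.Kˣ), gal g (𝔉.constEmb k) = 𝔉.constEmb k)
    (h5 : ∀ f : 𝔉.biratUnits 𝔉.BN, f ∈ 𝔉.KxRootN → f ^ (𝔉.N : ℕ) = 1 →
      f ∈ (𝔉.unitsToBirat 𝔉.BN).range) :
    𝔉.KxOuterActionExtends := by
  classical
  -- choose the cocycle `ζ_f(g) ∈ O^×(B_N)` with `ι(ζ_f(g)) = f · gal g (f)⁻¹`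
  have hex : ∀ (f : 𝔉.KxRootN) (g : Aut (𝔉.base.obj 𝔉.BN)), ∃ z : 𝔉.units 𝔉.BN,
      𝔉.unitsToBirat 𝔉.BN z = (f : 𝔉.biratUnits 𝔉.BN) * (gal g (f : 𝔉.biratUnits 𝔉.BN))⁻¹ :=
    fun f g => h5 _ (𝔉.kc_birat_mem_KxRootN gal h3 f g) (𝔉.kc_birat_pow_eq_one gal h3 f g)
  choose ζ hζ using hex
  have hmu : ∀ f g, ((ζ f g : 𝔉.units 𝔉.BN) : Aut 𝔉.BN) ∈ 𝔉.muTorsion 𝔉.BN 𝔉.N :=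
    𝔉.kc_mem_muTorsion gal ζ hζ h3
  have hEN : ∀ f g, ((ζ f g : 𝔉.units 𝔉.BN) : Aut 𝔉.BN) ∈ 𝔉.EN :=
    fun f g => le_sectionSubgroup 𝔉.sgpCap 𝔉.imPiY (𝔉.muTorsion 𝔉.BN 𝔉.N) (hmu f g)
  have hbase : ∀ f g (e : Aut 𝔉.BN),
      𝔉.autBase 𝔉.BN (((ζ f g : 𝔉.units 𝔉.BN) : Aut 𝔉.BN) * e) = 𝔉.autBase 𝔉.BN e :=
    fun f g e => 𝔉.autBase_units_mul (ζ f g) e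
  -- the shift by `ζ_f` as an automorphism of `E_N`
  let sh : 𝔉.KxRootN → MulAut 𝔉.EN := fun f =>
    { toFun := fun e => ⟨(ζ f (𝔉.autBase 𝔉.BN e) : Aut 𝔉.BN) * e, 𝔉.EN.mul_mem (hEN _ _) e.2⟩
      invFun := fun e => ⟨((ζ f (𝔉.autBase 𝔉.BN e) : Aut 𝔉.BN))⁻¹ * e,
        𝔉.EN.mul_mem (𝔉.EN.inv_mem (hEN _ _)) e.2⟩
      left_inv := fun e => by
        apply Subtype.ext
        change ((ζ f (𝔉.autBase 𝔉.BN (((ζ f (𝔉.autBase 𝔉.BN e) : Aut 𝔉.BN) * e))) : Aut 𝔉.BN))⁻¹ *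
            (((ζ f (𝔉.autBase 𝔉.BN e) : Aut 𝔉.BN)) * e) = e
        rw [hbase, inv_mul_cancel_left]
      right_inv := fun e => by
        apply Subtype.ext
        change ((ζ f (𝔉.autBase 𝔉.BN (((ζ f (𝔉.autBase 𝔉.BN e) : Aut 𝔉.BN))⁻¹ * e)) : Aut 𝔉.BN)) *
            ((((ζ f (𝔉.autBase 𝔉.BN e) : Aut 𝔉.BN))⁻¹) * e) = e
        have hb : 𝔉.autBase 𝔉.BN (((ζ f (𝔉.autBase 𝔉.BN e) : Aut 𝔉.BN))⁻¹ * (e : Aut 𝔉.BN)) =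
            𝔉.autBase 𝔉.BN e := by
          rw [map_mul, map_inv, 𝔉.autBase_coe_units, inv_one, one_mul]
        rw [hb, mul_inv_cancel_left]
      map_mul' := fun e₁ e₂ => by
        apply Subtype.ext
        change ((ζ f (𝔉.autBase 𝔉.BN ((e₁ : Aut 𝔉.BN) * e₂))) : Aut 𝔉.BN) * ((e₁ : Aut 𝔉.BN) * e₂) =
          ((ζ f (𝔉.autBase 𝔉.BN e₁) : Aut 𝔉.BN) * e₁) * ((ζ f (𝔉.autBase 𝔉.BN e₂) : Aut 𝔉.BN) * e₂)
        rw [map_mul, 𝔉.kc_cocycle gal ζ hζ hsec h2 f e₁.2 (𝔉.autBase 𝔉.BN e₂)]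
        group }
  have sh_apply : ∀ (f : 𝔉.KxRootN) (e : 𝔉.EN),
      ((sh f e : 𝔉.EN) : Aut 𝔉.BN) = (ζ f (𝔉.autBase 𝔉.BN e) : Aut 𝔉.BN) * e := fun _ _ => rfl
  -- `f ↦ sh f` is a homomorphism
  let act : 𝔉.KxRootN →* MulAut 𝔉.EN :=
    { toFun := sh
      map_one' := by
        apply MulEquiv.ext
        intro e
        apply Subtype.ext
        rw [sh_apply, 𝔉.kc_one gal ζ hζ]
        simp
      map_mul' := fun f f' => by
        apply MulEquiv.ext
        intro e
        apply Subtype.ext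
        rw [MulAut.mul_apply, sh_apply, sh_apply, sh_apply, hbase, 𝔉.kc_mul gal ζ hζ]
        simp [mul_assoc] }
  have act_apply : ∀ (f : 𝔉.KxRootN) (e : 𝔉.EN),
      ((act f e : 𝔉.EN) : Aut 𝔉.BN) = (ζ f (𝔉.autBase 𝔉.BN e) : Aut 𝔉.BN) * e := fun _ _ => rfl
  refine ⟨act, fun f e => ?_, fun u hu e => ?_⟩
  · rw [act_apply, mul_inv_cancel_right]
    exact hmu f _
  · rw [act_apply]
    exact 𝔉.kc_units gal ζ hζ hsec h2 u hu e.2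

/-! ### The same datum currency for rows L58-A3 and L58-B2 -/

/-- **L58-A3 from a Galois-action datum** (repackaging, for abc-iut-L2-t4's `Facts.ofSetting`): if `gal` is
compatible with the action on units (h2), fixes the constants (h3) and its `Im(Π^tp_Y̲)`-invariant
unit-images are constants (h4: "`(O^×(B_N))^{Π^tp_Y} ⊆ O_K^×`", `Y` geometrically connected over `K`,
[EtTh] Prop. 3.4 (ii)), then `InvariantUnitsEqConstants` holds.
[cite: MochizukiEtTh2009, Lem 5.8 proof p.331 (PDF p.105)] -/
theorem invariantUnitsEqConstants_of_galoisAction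
    (gal : Aut (𝔉.base.obj 𝔉.BN) →* MulAut (𝔉.biratUnits 𝔉.BN))
    (h2 : ∀ (g : Aut (𝔉.base.obj 𝔉.BN)) (u : 𝔉.units 𝔉.BN)
      (hu' : 𝔉.sgpCap g * (u : Aut 𝔉.BN) * (𝔉.sgpCap g)⁻¹ ∈ 𝔉.units 𝔉.BN),
      𝔉.unitsToBirat 𝔉.BN ⟨_, hu'⟩ = gal g (𝔉.unitsToBirat 𝔉.BN u))
    (h3 : ∀ (g : Aut (𝔉.base.obj 𝔉.BN)) (k : 𝔉.Kˣ), gal g (𝔉.constEmb k) = 𝔉.constEmb k)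
    (h4 : ∀ u : 𝔉.units 𝔉.BN, (∀ g ∈ 𝔉.imPiY, gal g (𝔉.unitsToBirat 𝔉.BN u) = 𝔉.unitsToBirat 𝔉.BN u) →
      𝔉.unitsToBirat 𝔉.BN u ∈ 𝔉.constEmb.range) :
    𝔉.InvariantUnitsEqConstants := by
  intro u
  have hmem : ∀ g : Aut (𝔉.base.obj 𝔉.BN),
      𝔉.sgpCap g * (u : Aut 𝔉.BN) * (𝔉.sgpCap g)⁻¹ ∈ 𝔉.units 𝔉.BN :=
    fun g => (𝔉.units_normal 𝔉.BN).conj_mem _ u.2 _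
  constructor
  · intro hfix
    apply h4
    intro g hg
    rw [← h2 g u (hmem g)]
    congr 1
    exact Subtype.ext (hfix g hg)
  · rintro ⟨k, hk⟩ g _
    have h := h2 g u (hmem g)
    rw [← hk, h3, hk] at h
    exact congrArg Subtype.val (𝔉.unitsToBirat_injective 𝔉.BN h)

/-- **L58-B2 reduced**: abc-iut-L2-t4's named statement `KxRootNModCyclotome` ("`(K^×)^{1/N}/μ_N(B_N) ⥲ K^×`":
the `N`-th power map is onto `K^×` with kernel `μ_N(B_N)`) follows from the DATA-level surjectivity (every
constant has an `N`-th root in `O^×(B_N^birat)`) together with (h5) (the `N`-torsion of `O^×(B_N^birat)`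
consists of units); the kernel clause is then automatic.
[cite: MochizukiEtTh2009, Lem 5.8 p.331 (PDF p.105)] -/
theorem kxRootNModCyclotome_of
    (hsurj : ∀ k : 𝔉.Kˣ, ∃ f ∈ 𝔉.KxRootN, f ^ (𝔉.N : ℕ) = 𝔉.constEmb k)
    (h5 : ∀ f : 𝔉.biratUnits 𝔉.BN, f ∈ 𝔉.KxRootN → f ^ (𝔉.N : ℕ) = 1 →
      f ∈ (𝔉.unitsToBirat 𝔉.BN).range) :
    𝔉.KxRootNModCyclotome := by
  refine ⟨hsurj, fun f hfK => ⟨fun hf => ?_, ?_⟩⟩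
  · obtain ⟨u, hu⟩ := h5 f hfK hf
    have huN : u ^ (𝔉.N : ℕ) = 1 := by
      apply 𝔉.unitsToBirat_injective 𝔉.BN
      rw [map_pow, hu, hf, map_one]
    have hmem : (u : Aut 𝔉.BN) ∈ 𝔉.muTorsion 𝔉.BN 𝔉.N := by
      rw [mem_muTorsion]
      exact ⟨u.2, by simpa [Subgroup.coe_pow] using congrArg Subtype.val huN⟩
    exact ⟨⟨u, hmem⟩, hu⟩
  · rintro ⟨z, rfl⟩
    rw [MonoidHom.comp_apply, ← map_pow]
    have hz : (Subgroup.inclusion (𝔉.muTorsion_le_units 𝔉.BN 𝔉.N) z) ^ (𝔉.N : ℕ) = 1 := by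
      apply Subtype.ext
      simpa [Subgroup.coe_pow] using (𝔉.mem_muTorsion.mp z.2).2
    rw [hz, map_one]

/-! ### At abc-iut-L2-t11's datum `BiratAutAction` (construction of record for the `DK` slot, p417098) -/

/-- **Row L58-B1 DERIVED at the datum of record.**  For §5 data with the section property of `s^⊓-gp_N`, a
birational action `α : BiratAutAction` (abc-iut-L2-t11, `FrobenioidKummerOut.lean`) and "`(K^×)^{1/N}/μ_N(B_N)
⥲ K^×`" (abc-iut-L2-t4's `KxRootNModCyclotome`, whose second clause supplies "`N`-torsion roots are units"), the
conjugation action of `(O_K^×)^{1/N}` on `E_N` extends to a Kummer action of `(K^×)^{1/N}` — Lemma 5.8's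
"extends to an outer action … on `E_N`" (`KxOuterActionExtends`), via `gal := α.act ∘ s^⊓-gp_N`.
[cite: MochizukiEtTh2009, Lem 5.8 p.331 (PDF p.105)] -/
theorem kxOuterActionExtends_of_biratAutAction (hsec : 𝔉.SgpCapSection) (α : 𝔉.BiratAutAction)
    (hK : 𝔉.KxRootNModCyclotome) : 𝔉.KxOuterActionExtends :=
  𝔉.kxOuterActionExtends_of_galoisAction hsec (α.act.comp 𝔉.sgpCap)
    (fun g u hu' => by
      rw [MonoidHom.comp_apply, α.act_unitsToBirat])
    (fun g k => by rw [MonoidHom.comp_apply, α.act_constEmb])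
    (fun f hf hfN => by
      obtain ⟨z, hz⟩ := (hK.2 f hf).mp hfN
      exact ⟨Subgroup.inclusion (𝔉.muTorsion_le_units 𝔉.BN 𝔉.N) z, hz⟩)

/-- **Row L58-A3 at the datum of record**: with `α : BiratAutAction`, "`(O^×(B_N))^{Π^tp_Y} = O_K^×`"
(`InvariantUnitsEqConstants`) reduces to its `⊆` half `h4` — the `Im(Π^tp_Y̲)`-invariant unit-images are
constants ("`Y` geometrically connected over `K`", `K̈ = K`; [EtTh] Prop. 3.4 (ii)).
[cite: MochizukiEtTh2009, Lem 5.8 proof p.331 (PDF p.105)] -/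
theorem invariantUnitsEqConstants_of_biratAutAction (α : 𝔉.BiratAutAction)
    (h4 : ∀ u : 𝔉.units 𝔉.BN,
      (∀ g ∈ 𝔉.imPiY, α.act (𝔉.sgpCap g) (𝔉.unitsToBirat 𝔉.BN u) = 𝔉.unitsToBirat 𝔉.BN u) →
      𝔉.unitsToBirat 𝔉.BN u ∈ 𝔉.constEmb.range) :
    𝔉.InvariantUnitsEqConstants :=
  𝔉.invariantUnitsEqConstants_of_galoisAction (α.act.comp 𝔉.sgpCap)
    (fun g u hu' => by rw [MonoidHom.comp_apply, α.act_unitsToBirat])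
    (fun g k => by rw [MonoidHom.comp_apply, α.act_constEmb])
    (fun u hu => h4 u (fun g hg => by simpa [MonoidHom.comp_apply] using hu g hg))

/-- **Row L58-B2 at the datum of record**: `KxRootNModCyclotome` from the surjectivity datum and a
`BiratAutAction`-free input — here only the weak (h5) is needed, which `KxRootNModCyclotome` itself contains; so
this is the honest residual: SURJECTIVITY of the `N`-th power map onto `K^×` plus "`N`-torsion roots are units".
[cite: MochizukiEtTh2009, Lem 5.8 p.331 (PDF p.105)] -/
theorem kxRootNModCyclotome_iff :
    𝔉.KxRootNModCyclotome ↔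
      (∀ k : 𝔉.Kˣ, ∃ f ∈ 𝔉.KxRootN, f ^ (𝔉.N : ℕ) = 𝔉.constEmb k) ∧
        ∀ f : 𝔉.biratUnits 𝔉.BN, f ∈ 𝔉.KxRootN → f ^ (𝔉.N : ℕ) = 1 →
          f ∈ (𝔉.unitsToBirat 𝔉.BN).range := by
  constructor
  · intro hK
    refine ⟨hK.1, fun f hf hfN => ?_⟩
    obtain ⟨z, hz⟩ := (hK.2 f hf).mp hfN
    exact ⟨Subgroup.inclusion (𝔉.muTorsion_le_units 𝔉.BN 𝔉.N) z, hz⟩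
  · rintro ⟨hsurj, h5⟩
    exact 𝔉.kxRootNModCyclotome_of hsurj h5

end ThetaFrobenioid

end Literature.AnabelianGeometry.EtaleTheta
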